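import Summits.CriticalPhenomena.CardyFormulaZ2.Theorems.CardyIKTransportIKMixedBoxCrossingStubDuality
import Literature.Probability.Percolation.DualContours

/-!
# Stub `stub_glueStep` (line `defect-closure-exploration` v7, crux `IKMixedBoxCrossing`, stmt-CriticalPhenomena-5911)

Support file (`--supports stmt-CriticalPhenomena-5911`): the deterministic PLANAR GLUE STEP of the two RSW
assemblies of skeleton v7 (`stub_rswAssembly`, `stub_squaresFromTall`).  For an observable configuration
`x`, a black LR crossing of box₁ `= [a, a+w₁) × [b, b+h)`, a black LR crossing of box₂
`= [a+d, a+d+w₂) × [b, b+h)` (`d < w₁ ≤ d + w₂`, so the two boxes overlap in the strip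
`O = [a+d, a+w₁) × [b, b+h)`) and a black TB crossing of `O` give a black LR crossing of the union
`[a, a+d+w₂) × [b, b+h)` (`glueStep` = `stub_glueStep`, registered signature).

Proof (site reading of the bond events through the landed dictionary `pathIn_of_mem_openConnIn` /
`mem_openConnIn_of_pathIn` of `…StubDuality`).
* PATH SURGERY (§1): the support of a path (`pathIn_support`), a discrete intermediate value lemma
  (`pathIn_reach_level`), and the restrictions of a path to a right / left part of the plane
  (`pathIn_restrict_right` / `pathIn_restrict_left`), all from the tree's first-exit / last-visit lemmas
  (`PathIn.exit`, `PathIn.last_exit`); steps of the triangulation move each coordinate by `≤ 1`.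
* CROSS-MEET (§2, `meet`): an LR path and a TB path of black cells of the SAME box share a cell.  For a box
  of width and height `≥ 2` this is the landed pointwise duality `xor_lrCross_tbCross` applied to the
  RECOLOURED configuration `(cells of the LR path, x.2)`: were the two paths disjoint, the TB path would be a
  black TB crossing of the colour-flipped recolouring (`meet_of_dual`); a box of width `1` is a column, which
  the TB path sweeps row by row (`pathIn_reach_level`).
* GLUE (§3): restrict the LR path of box₁ to its terminal piece in `O` and the LR path of box₂ to its
  initial piece in `O`; both are LR crossings of `O`, so each meets the TB crossing of `O`, and the TB
  crossing joins the two meeting cells; a box of height `1` is a row, where the two pieces share their first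
  cell.  The cases `d = 0` and `w₁ = d + w₂` are tautologies (one box contains the other).
-/

namespace Summit.CriticalPhenomena.CardyFormulaZ2.Cruxes.IKMixedBoxCrossing.QuenchedChainFKG

open Literature.Probability.Percolation Literature.Probability.LatticeModels
open Summit.CriticalPhenomena.CardyFormulaZ2.Theorems.IKLinearTransport.PinnedDiagramExchange
  (Ω μIK Obs obs lrCross tbCross blackEdges)
open Summit.CriticalPhenomena.CardyFormulaZ2.Theorems.IKLinearTransport.PinnedDiagramExchange
  renaming cellGraph → obsGraph
open Summit.CriticalPhenomena.CardyFormulaZ2.Cruxes.IKMixedBoxCrossing.PairedMirrorExploration.DualityStub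
  (xor_lrCross_tbCross pathIn_of_mem_openConnIn mem_openConnIn_of_pathIn)

namespace GlueStep

/-! ## §1 Path surgery -/

/-- SUPPORT OF A PATH: a path inside `A` from `u` to `v` runs inside a set `T ⊆ A` of cells each of which
is joined inside `A` to `u` (backwards along the path) and to `v` (forwards). [folklore] -/
theorem pathIn_support {V : Type*} {G : SimpleGraph V} {A : Set V} {u v : V} (h : PathIn G A u v) :
    ∃ T : Set V, T ⊆ A ∧ PathIn G T u v ∧ ∀ z ∈ T, PathIn G A u z ∧ PathIn G A z v := by
  obtain ⟨hu, h⟩ := h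
  induction h with
  | refl =>
    refine ⟨{u}, Set.singleton_subset_iff.2 hu, PathIn.refl (Set.mem_singleton u), fun z hz => ?_⟩
    rw [Set.mem_singleton_iff] at hz
    subst hz
    exact ⟨PathIn.refl hu, PathIn.refl hu⟩
  | @tail b c hub hbc ih =>
    obtain ⟨T, hTA, hT, hTz⟩ := ih
    refine ⟨insert c T, Set.insert_subset hbc.2 hTA,
      (hT.mono (Set.subset_insert _ _)).tail hbc.1 (Set.mem_insert _ _), ?_⟩
    rintro z (rfl | hz)
    · exact ⟨⟨hu, hub.tail hbc⟩, PathIn.refl hbc.2⟩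
    · exact ⟨(hTz z hz).1, (hTz z hz).2.tail hbc.1 hbc.2⟩

/-- Along an edge of the triangulation `obsGraph F` both coordinates change by at most `1` (the steps are
`(1,0), (0,1), (1,1), (1,-1)` up to orientation). [folklore] -/
theorem obsGraph_adj_apply_le {F : Set (Site 2)} {u v : Site 2} (h : (obsGraph F).Adj u v) :
    v 0 ≤ u 0 + 1 ∧ u 0 ≤ v 0 + 1 ∧ v 1 ≤ u 1 + 1 ∧ u 1 ≤ v 1 + 1 := by
  obtain ⟨-, hr | hr⟩ := (SimpleGraph.fromRel_adj _ _ _).1 h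
  · rcases hr with rfl | rfl | ⟨rfl, -⟩ | ⟨rfl, -⟩ <;> simp <;> omega
  · rcases hr with rfl | rfl | ⟨rfl, -⟩ | ⟨rfl, -⟩ <;> simp <;> omega

/-- Along an edge of `obsGraph F` the coordinate `i` increases by at most `1`. [folklore] -/
theorem obsGraph_step {F : Set (Site 2)} {u v : Site 2} (h : (obsGraph F).Adj u v) (i : Fin 2) :
    v i ≤ u i + 1 := by
  have h4 := obsGraph_adj_apply_le h
  fin_cases i
  · exact h4.1
  · exact h4.2.2.1

/-- DISCRETE INTERMEDIATE VALUE: a path of `obsGraph F` inside `A` from a cell with `i`-th coordinate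
`≤ k` to a cell with `i`-th coordinate `≥ k` visits a cell with `i`-th coordinate `= k`, reached by an
initial piece of the path (inside `A`). [folklore] -/
theorem pathIn_reach_level {F A : Set (Site 2)} {u v : Site 2} (h : PathIn (obsGraph F) A u v)
    (i : Fin 2) {k : ℤ} (hu : u i ≤ k) (hv : k ≤ v i) : ∃ w, w i = k ∧ PathIn (obsGraph F) A u w := by
  rcases hu.eq_or_lt with hk | hk
  · exact ⟨u, hk, PathIn.refl h.left_mem⟩
  · obtain ⟨a', b', ha', hb', hb'A, hadj, hp⟩ := h.exit (R := {z : Site 2 | z i < k}) hk (not_lt.2 hv)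
    have h1 : a' i < k := ha'
    have h2 : ¬ b' i < k := hb'
    have h3 := obsGraph_step hadj i
    exact ⟨b', by omega, (hp.mono Set.inter_subset_right).tail hadj hb'A⟩

/-- RESTRICTION TO A RIGHT PART: a path of `obsGraph F` inside `A` from a cell left of column `c` to a cell
in column `≥ c` has a terminal piece inside `A ∩ {column ≥ c}` starting on column `c` (after its last
visit left of `c`). [folklore] -/
theorem pathIn_restrict_right {F A : Set (Site 2)} {u v : Site 2} (h : PathIn (obsGraph F) A u v)
    {c : ℤ} (hu : u 0 < c) (hv : c ≤ v 0) :
    ∃ w, w 0 = c ∧ PathIn (obsGraph F) (A ∩ {z : Site 2 | c ≤ z 0}) w v := by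
  obtain ⟨a', b', ha', -, hb', hadj, hp⟩ := h.last_exit (C := {z : Site 2 | z 0 < c}) hu (not_lt.2 hv)
  have h1 : a' 0 < c := ha'
  have h2 : ¬ b' 0 < c := hb'
  have h3 := obsGraph_step hadj 0
  exact ⟨b', by omega, hp.mono fun z hz => ⟨hz.1, not_lt.1 (show ¬ z 0 < c from hz.2)⟩⟩

/-- RESTRICTION TO A LEFT PART: a path of `obsGraph F` inside `A` from a cell left of column `c` to a cell
in column `≥ c` has an initial piece inside `A ∩ {column < c}` ending on column `c - 1` (before its first
exit). [folklore] -/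
theorem pathIn_restrict_left {F A : Set (Site 2)} {u v : Site 2} (h : PathIn (obsGraph F) A u v)
    {c : ℤ} (hu : u 0 < c) (hv : c ≤ v 0) :
    ∃ w, w 0 = c - 1 ∧ PathIn (obsGraph F) (A ∩ {z : Site 2 | z 0 < c}) u w := by
  obtain ⟨a', b', ha', hb', -, hadj, hp⟩ := h.exit (R := {z : Site 2 | z 0 < c}) hu (not_lt.2 hv)
  have h1 : a' 0 < c := ha'
  have h2 : ¬ b' 0 < c := hb'
  have h3 := obsGraph_step hadj 0
  exact ⟨a', by omega, hp.mono fun z hz => ⟨hz.2, hz.1⟩⟩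

/-! ## §2 An LR path and a TB path of the same box meet

Boxes are written exactly as the vertex sets of the events `lrCross` / `tbCross` unfold. -/

/-- CROSS-MEET BY DUALITY (box of width and height `≥ 2`): a path `P` of the triangulation from the left
column to the right column of the box and a path `Q` from its bottom row to its top row, both inside the
box, share a cell.  Otherwise, in the recoloured configuration `(cells of P, F)` the path `P` is a black LR
crossing while `Q` is a black TB crossing of the colour flip `((cells of P)ᶜ, F)`, against the pointwise
duality `xor_lrCross_tbCross`. [folklore] -/
theorem meet_of_dual {F T T' : Set (Site 2)} {c b : ℤ} {m n : ℕ} (hm : 1 ≤ m) (hn : 1 ≤ n)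
    {u v p q : Site 2} (hP : PathIn (obsGraph F) T u v)
    (hT : T ⊆ {v : Site 2 | c ≤ v 0 ∧ v 0 < c + (m + 1 : ℕ) ∧ b ≤ v 1 ∧ v 1 < b + (n + 1 : ℕ)})
    (hu : u 0 = c) (hv : v 0 = c + m) (hQ : PathIn (obsGraph F) T' p q)
    (hT' : T' ⊆ {v : Site 2 | c ≤ v 0 ∧ v 0 < c + (m + 1 : ℕ) ∧ b ≤ v 1 ∧ v 1 < b + (n + 1 : ℕ)})
    (hp : p 1 = b) (hq : q 1 = b + n) : ∃ z, z ∈ T ∧ z ∈ T' := by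
  by_contra h
  push Not at h
  have hLR : ((T, F) : Obs) ∈ lrCross c b (m + 1) (n + 1) := by
    have hu' := hT hP.left_mem
    have hv' := hT hP.right_mem
    simp only [Set.mem_setOf_eq] at hu' hv'
    simp only [lrCross, Set.mem_setOf_eq, mem_openCrossing_iff]
    exact ⟨u, ⟨hu, by omega, by omega⟩, v, ⟨by omega, by omega, by omega⟩,
      mem_openConnIn_of_pathIn (hP.mono fun z hz => ⟨hT hz, hz⟩)⟩
  have hTB : ((Tᶜ, F) : Obs) ∈ tbCross c b (m + 1) (n + 1) := by
    have hp' := hT' hQ.left_mem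
    have hq' := hT' hQ.right_mem
    simp only [Set.mem_setOf_eq] at hp' hq'
    simp only [tbCross, Set.mem_setOf_eq, mem_openCrossing_iff]
    exact ⟨p, ⟨hp, by omega, by omega⟩, q, ⟨by omega, by omega, by omega⟩,
      mem_openConnIn_of_pathIn (hQ.mono fun z hz => ⟨hT' hz, fun hzT => h z hzT hz⟩)⟩
  rcases xor_lrCross_tbCross ((T, F) : Obs) c b hm hn with ⟨-, h2⟩ | ⟨-, h2⟩
  · exact h2 hTB
  · exact h2 hLR

/-- CROSS-MEET (box of height `≥ 2`, any width `k + 1 ≥ 1`): a left-to-right path `P` and a bottom-to-top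
path `Q` of the triangulation inside the same box share a cell — by duality (`meet_of_dual`) for width
`≥ 2`, and for width `1` because `Q`, confined to one column, visits the row of the first cell of `P`
(`pathIn_reach_level`). [folklore] -/
theorem meet {F T T' : Set (Site 2)} {c b : ℤ} {k n : ℕ} (hn : 1 ≤ n) {u v p q : Site 2}
    (hP : PathIn (obsGraph F) T u v)
    (hT : T ⊆ {v : Site 2 | c ≤ v 0 ∧ v 0 < c + (k + 1 : ℕ) ∧ b ≤ v 1 ∧ v 1 < b + (n + 1 : ℕ)})
    (hu : u 0 = c) (hv : v 0 = c + k) (hQ : PathIn (obsGraph F) T' p q)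
    (hT' : T' ⊆ {v : Site 2 | c ≤ v 0 ∧ v 0 < c + (k + 1 : ℕ) ∧ b ≤ v 1 ∧ v 1 < b + (n + 1 : ℕ)})
    (hp : p 1 = b) (hq : q 1 = b + n) : ∃ z, z ∈ T ∧ z ∈ T' := by
  rcases Nat.eq_zero_or_pos k with rfl | hk
  · have huT := hP.left_mem
    have hu' := hT huT
    have hq' := hT' hQ.right_mem
    simp only [Set.mem_setOf_eq] at hu' hq'
    obtain ⟨w, hw, hpw⟩ := pathIn_reach_level hQ 1 (k := u 1) (by omega) (by omega)
    have hwT' := hpw.right_mem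
    have hw' := hT' hwT'
    simp only [Set.mem_setOf_eq] at hw'
    have e : w = u := Contour.site_ext (by omega) hw
    exact ⟨u, huT, e ▸ hwT'⟩
  · exact meet_of_dual hk hn hP hT hu hv hQ hT' hp hq

end GlueStep

open GlueStep in
/-- **GLUE STEP** (deterministic planar topology): for every observable configuration, a black LR crossing
of `[a, a+w₁) × [b, b+h)`, a black LR crossing of `[a+d, a+d+w₂) × [b, b+h)` with `d < w₁ ≤ d + w₂`, and a
black TB crossing of the overlap strip `[a+d, a+w₁) × [b, b+h)` give a black LR crossing of the union
`[a, a+d+w₂) × [b, b+h)`. [folklore] -/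
theorem glueStep : ∀ (x : Obs) (a b : ℤ) (d w₁ w₂ h : ℕ), d < w₁ → w₁ ≤ d + w₂ →
    x ∈ lrCross a b w₁ h → x ∈ lrCross (a + d) b w₂ h → x ∈ tbCross (a + d) b (w₁ - d) h →
    x ∈ lrCross a b (d + w₂) h := by
  intro x a b d w₁ w₂ h hd hw h1 h2 h3
  -- the two tautological cases: one box contains the other
  rcases Nat.eq_zero_or_pos d with rfl | hd0
  · simpa using h2
  rcases hw.eq_or_lt with rfl | hw'
  · exact h1
  -- normal forms: overlap width `k + 1`, height `n + 1`
  obtain ⟨k, hk⟩ : ∃ k, w₁ - d = k + 1 := ⟨w₁ - d - 1, by omega⟩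
  rw [hk] at h3
  simp only [lrCross, tbCross, Set.mem_setOf_eq, mem_openCrossing_iff] at h1 h2 h3 ⊢
  obtain ⟨u₁, ⟨hu₁0, hu₁1, hu₁2⟩, v₁, ⟨hv₁0, hv₁1, hv₁2⟩, h1⟩ := h1
  obtain ⟨u₂, ⟨hu₂0, hu₂1, hu₂2⟩, v₂, ⟨hv₂0, hv₂1, hv₂2⟩, h2⟩ := h2
  obtain ⟨n, rfl⟩ : ∃ n, h = n + 1 := ⟨h - 1, by omega⟩
  -- the two LR paths (site reading), their supports, and their pieces in the overlap strip
  obtain ⟨T₁, hT₁A, hP₁, hT₁⟩ := pathIn_support (pathIn_of_mem_openConnIn (by rintro rfl; omega) h1)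
  obtain ⟨T₂, hT₂A, hP₂, hT₂⟩ := pathIn_support (pathIn_of_mem_openConnIn (by rintro rfl; omega) h2)
  obtain ⟨s₁, hs₁, hP₁'⟩ := pathIn_restrict_right hP₁ (c := a + d) (by omega) (by omega)
  obtain ⟨t₂, ht₂, hP₂'⟩ := pathIn_restrict_left hP₂ (c := a + d + (k + 1)) (by omega) (by omega)
  have hO₁ : T₁ ∩ {z : Site 2 | a + ↑d ≤ z 0} ⊆
      {v : Site 2 | a + d ≤ v 0 ∧ v 0 < a + d + (k + 1 : ℕ) ∧ b ≤ v 1 ∧ v 1 < b + (n + 1 : ℕ)} := by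
    rintro y ⟨hy, hy'⟩
    have hy₁ := (hT₁A hy).1
    simp only [Set.mem_setOf_eq] at hy₁ hy' ⊢
    omega
  have hO₂ : T₂ ∩ {z : Site 2 | z 0 < a + ↑d + (↑k + 1)} ⊆
      {v : Site 2 | a + d ≤ v 0 ∧ v 0 < a + d + (k + 1 : ℕ) ∧ b ≤ v 1 ∧ v 1 < b + (n + 1 : ℕ)} := by
    rintro y ⟨hy, hy'⟩
    have hy₂ := (hT₂A hy).1
    simp only [Set.mem_setOf_eq] at hy₂ hy' ⊢
    omega
  -- KEY: a cell of `P₁` is joined to a cell of `P₂` inside the union box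
  have key : ∃ z ∈ T₁, ∃ z' ∈ T₂, PathIn (obsGraph x.2)
      ({v : Site 2 | a ≤ v 0 ∧ v 0 < a + (d + w₂ : ℕ) ∧ b ≤ v 1 ∧ v 1 < b + (n + 1 : ℕ)} ∩ x.1) z z' := by
    rcases Nat.eq_zero_or_pos n with rfl | hn
    · -- one row: the first cell of the piece of `P₁` in the strip is the first cell of `P₂`
      have hs₁T : s₁ ∈ T₁ := hP₁'.left_mem.1
      have hu₂T : u₂ ∈ T₂ := hP₂.left_mem
      have hs₁' := (hT₁A hs₁T).1
      simp only [Set.mem_setOf_eq] at hs₁'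
      have e : s₁ = u₂ := Contour.site_ext (by omega) (by omega)
      refine ⟨u₂, e ▸ hs₁T, u₂, hu₂T, PathIn.refl ⟨?_, (hT₂A hu₂T).2⟩⟩
      simp only [Set.mem_setOf_eq]
      omega
    · -- at least two rows: both pieces meet the TB crossing `Q` of the strip, which joins them
      obtain ⟨p, ⟨hp1, hp0, hp0'⟩, q, ⟨hq1, hq0, hq0'⟩, h3⟩ := h3
      obtain ⟨T₃, hT₃A, hQ, hT₃⟩ :=
        pathIn_support (pathIn_of_mem_openConnIn (by rintro rfl; omega) h3)
      have hO₃ := fun y (hy : y ∈ T₃) => (hT₃A hy).1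
      obtain ⟨z, hz₁, hz₃⟩ := meet hn hP₁' hO₁ hs₁ (by omega) hQ hO₃ hp1 (by omega)
      obtain ⟨z', hz'₂, hz'₃⟩ := meet hn hP₂' hO₂ hu₂0 (by omega) hQ hO₃ hp1 (by omega)
      refine ⟨z, hz₁.1, z', hz'₂.1, ((hT₃ z hz₃).2.trans (hT₃ z' hz'₃).2.symm).mono fun y hy => ⟨?_, hy.2⟩⟩
      have hy' := hy.1
      simp only [Set.mem_setOf_eq] at hy' ⊢
      omega
  -- GLUE: `u₁ → z` along `P₁`, `z → z'` by the key, `z' → v₂` along `P₂`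
  obtain ⟨z, hz, z', hz', hzz'⟩ := key
  refine ⟨u₁, ⟨hu₁0, hu₁1, hu₁2⟩, v₂, ⟨by omega, hv₂1, hv₂2⟩,
    mem_openConnIn_of_pathIn ((((hT₁ z hz).1.mono ?_).trans hzz').trans ((hT₂ z' hz').2.mono ?_))⟩
  · intro y hy
    have hy' := hy.1
    simp only [Set.mem_setOf_eq] at hy'
    exact ⟨by simp only [Set.mem_setOf_eq]; omega, hy.2⟩
  · intro y hy
    have hy' := hy.1
    simp only [Set.mem_setOf_eq] at hy'
    exact ⟨by simp only [Set.mem_setOf_eq]; omega, hy.2⟩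

/-- **STUB `stub_glueStep`** (registered signature; = `glueStep`): the planar glue step of the RSW
assemblies of skeleton v7 — two overlapping black LR box crossings and a black TB crossing of the overlap
strip glue to a black LR crossing of the union box. [folklore] -/
theorem stub_glueStep : ∀ (x : Obs) (a b : ℤ) (d w₁ w₂ h : ℕ), d < w₁ → w₁ ≤ d + w₂ →
    x ∈ lrCross a b w₁ h → x ∈ lrCross (a + d) b w₂ h → x ∈ tbCross (a + d) b (w₁ - d) h →
    x ∈ lrCross a b (d + w₂) h :=
  glueStep

end Summit.CriticalPhenomena.CardyFormulaZ2.Cruxes.IKMixedBoxCrossing.QuenchedChainFKG
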